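import Summits.KontsevichZagierPeriods.KontsevichZagierPeriods.Theses.WeightFloor

/-!
# `LayerOfFrame` (stmt-KontsevichZagierPeriods-12249, route WeightFloor) — proof

`LayerOfFrame : VolumeForm → SmoothOvalSector`: the smooth-stone layer of route WeightFloor (two
integrand-`1` representations of dimension `2` over smooth stones with equal area are KZ-equivalent)
is a literal specialisation of the route's frame `VolumeForm` (two integrand-`1` representations of
ANY one dimension `N` with equal value are KZ-equivalent): instantiate `VolumeForm` at `N = 2` and the
two given representations and discard the two smooth-stone regularity hypotheses. Pure logic over the
route's own definitions, no new definitions; planner-proved glue (item docstring: `layerOfFrame_holds`,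
2 lines, in the route's Sketch.lean), landed by lead c10 of crux stmt-KontsevichZagierPeriods-9129
(banking). With the kill criterion of the route it reads `¬ SmoothOvalSector ⇒ ¬ VolumeForm`.
Source: M. Kontsevich, D. Zagier, *Periods* (2001), §1.2.
-/

namespace Summit.KontsevichZagierPeriods.WeightFloor

/-- **`LayerOfFrame`** (route WeightFloor, stmt-KontsevichZagierPeriods-12249):
`VolumeForm → SmoothOvalSector` — `SmoothOvalSector` is `VolumeForm` at dimension `N = 2` with two
extra (unused) smooth-stone hypotheses on the domains; proof = instantiate and drop them.
[folklore] -/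
theorem layerOfFrame_proof :
    Summit.KontsevichZagierPeriods.KontsevichZagierPeriods.Theses.WeightFloor.LayerOfFrame :=
  fun hV r r' h₁ h₁' _ _ hv => hV r r' h₁ h₁' hv

end Summit.KontsevichZagierPeriods.WeightFloor
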